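import Summits.QuantumFields.YangMills.Theorems.UnitScaleTiltHalvingCombStepReadings
import Summits.QuantumFields.YangMills.Theorems.UnitScaleTiltHalvingCombTorusOneStep
import Summits.QuantumFields.YangMills.Theorems.UnitScaleTiltHalvingDbarLipschitz
import Summits.QuantumFields.YangMills.Theorems.UnitScaleTiltHalvingP1FlatCoreCovariance
import Summits.QuantumFields.YangMills.Theorems.UnitScaleTiltHalvingTopCrossingDictionaryCore
import Summits.QuantumFields.YangMills.Theorems.UnitScaleTiltProp7SymFrameIterSmall
import Literature.MathematicalPhysics.QuantumFieldTheory.Balaban1983to89.B7Prop5Flat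
import HarnessLib

/-!
# Line H (`BirthV10.stub_halvingStep`, stmt-QuantumFields-19200) — LEMMA B-al-2, brick (B-iv), STEP ESTIMATE FILE 2∕2: ★★ `H_j ⇒ H_{j+1}` — the single-bar comb average of a
# block-axial `ℤᵈ` field stays within `(11∕10)·A·ρ + 5·c₁·(L·δc·p)²` of the pulled torus double bar ([Balaban1985Averaging] (42)∕(89), [Balaban1987RG1] (0.4))

Cell `ym3-torus` (HUMAN RULING D-0037: YM₃ on T³ is ladder rung R3 — NOT d = 4, NOT infinite volume, NOT a mass gap, NOT the Clay problem), width seat `ym3-torus-px15` gen 4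
(★★OWNER ym3-torus-plan g29 WORD 2026-08-29T04:11:16Z «B-al-2 PENS — ZERO TWINS» (1): px15 = the §3 STEP ESTIMATE on top of ★w3-19200 g10's GEOMETRY HALF
✓`UnitScaleTiltHalvingCombStepGeometry`; LEAD-H ★w5-19200 g7 WORD 20 (3): the B-al (b)-row is the one remaining analytic input of `stub_halvingStep`'s v10).
`--supports stmt-QuantumFields-19200 --as helper`; THEOREMS ONLY (0 `def`, 0 `sorry`); count-neutral; nothing here claims B-al-2's tower (B-v), `H42topCrossT`, (M2′), the stub,
the crux or the gap.

WHAT.  Level `j` of the torus tower (`π_j = coverAt j : ℤᵈ → T^{(j)}`).  DATA: a `U1`-valued `ℤᵈ` field `C` (the comb level `C_j`), BLOCK-AXIAL on every block, plaquettes `≤ p` on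
every box; a torus field `D` (the double-bar level `D_j`) with the INDUCTION HYPOTHESIS `H_j`: `‖D(π_j b)⁻¹·C(b) − 1‖ ≤ ρ` at every `ℤᵈ` bond.  CLAIM `H_{j+1}` at `ĉ = ⟨π_{j+1} z, κ⟩`
(statement = px3 g5's `hstep` text, bus 2026-08-29T04:09:38Z — the hypothesis of the (B-v) tower):
  ★★ `norm_dbarAvgU_inv_mul_bavg_sub_one_le`: **`‖(dbarAvgU D ĉ)⁻¹ · bavg L C (Lz) κ − 1‖ ≤ (11∕10)·A·ρ + 5·c₁·(L·(δc·p))²`**, `A = 2((d+2)L + L + 2·d⌊(L−1)∕2⌋)` (✓(B-iii)),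
  `c₁ = C₂(d) + 40000(d+2)²` (✓B-al-1), `δc = (2dL+1)(d(L−1)+L)` (✓(B-i)), under `10⁴·((d+2)L)·(δc·p + 2ρ) ≤ 1`, `L·(2·δc·p) ≤ c₄(d)` — NO gauge factor, NO further window
  (`c₄ = C₂⁻¹` gives `c₁·(2Lδc·p)² ≤ 2·10⁻³`).
ROUTE (★w3-19200 g10's HANDOFF chain (a)–(g); letters `f ṽ v S W g` of FILE 1 ✓`UnitScaleTiltHalvingCombStepReadings`):
* ★ `norm_inv_dbarAvgU_mul_dbavg_sub_one_le` — THE SECOND-ORDER LEG: `‖(dbarAvgU S ĉ)⁻¹·dbavg L (v•C) (Lz) κ − 1‖ ≤ exp(2a′ + r₂)·r₂`, `r₂ = c₁(L·2δc·p)²`: locality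
  `dbavg(v•C) = dbavg(e^B)`, `B = mlog ∘ S ∘ π_j` (lit ✓`B7Prop5Flat.dbavg_congr`, ✓`MatrixLog.exp_mlog`), ✓B-al-1 ✓`HalvingCombTorusOneStep.norm_mlog_dbavg_sub_mlog_dbarAvgU_le` at
  `r = 2δc·p`, exponential forms from ✓`Prop8ChartDoubleBar.norm_dbarAvgU_sub_one_le` ∕ ✓`HalvingDbavgOneStepLocal.norm_mlog_dbavg_sub_linQ_le_local`, closing
  ✓`HalvingTopCrossingDictionaryCore.norm_inv_mul_sub_one_le_of_exp`.
* ★ `norm_inv_dbarAvgU_gauged_mul_dbarAvgU_sectioned_sub_one_le` — THE LIPSCHITZ LEG: `‖(dbarAvgU W ĉ)⁻¹·dbarAvgU S ĉ − 1‖ ≤ A·(102∕100)ρ` (✓(B-iii)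
  ✓`HalvingDbarLipschitz.norm_dbarAvgU_inv_mul_sub_one_le` over FILE 1's ✓`twoBlock_readings`).
* ★★ `norm_dbarAvgU_inv_mul_bavg_sub_one_le` — THE STEP: `f = 1[ĉ₊ ↦ g]`; (a) `dbavg(v•C) = bavg C·g⁻¹` (✓(B-ii) ✓`dbavg_gaugeAct_eq_of_blockConst`); (e) `dbarAvgU W ĉ = dbarAvgU D ĉ·g⁻¹`
  (✓`P1FlatCoreCovariance.dbarAvgU_gaugeActT_of_blockConst`); (f) `D̿(ĉ)⁻¹·C̄ = g⁻¹·[(W̿)⁻¹S̿]·[S̿⁻¹·dbavg(v•C)]·g`, conjugation by `g ∈ U1` (lit ✓`norm_units_inv_conj_sub_one_le`, ✓`Prop7SymFrameIterSmall.norm_mul_sub_one_le_three`),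
  the two legs, and FILE 1's `step_arith` ∕ `windows_arith`.
HONEST SCOPE.  One level, one coarse bond; the k-level recursion, the member instance and the `PlaqSmall` corollary are (B-v) (px3 g5 ∕ px10 g4), NOT here.

References: T. Bałaban, CMP **98** (1985) 17–51 [Balaban1985Averaging] ((11) p.19, (42) p.23, p.24, (89) p.31, (121)–(125) p.36, Prop. 4 (134)–(135) pp.38–39); CMP **109**
(1987) 249–301 [Balaban1987RG1] ((0.1)–(0.4) pp.251–253); CMP **102** (1985) 255–275 [Balaban1985UV3] ((27)–(28) p.263).
-/

set_option autoImplicit false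

noncomputable section

open scoped BigOperators Matrix.Norms.L2Operator
open NormedSpace

namespace Summit.QuantumFields.YangMills.Theorems.HalvingCombStep

open Literature.MathematicalPhysics.QuantumFieldTheory.Balaban1983to89
open Literature.MathematicalPhysics.QuantumLattice (blockMap)
open B14DomainGeom (Pt)
open Node00 (coverAt coverAt_apply blockOf_coverAt coverAt_add_e)
open B7Prop1Explicit (e e_apply boxVec axialFn gaugeAct l1 U1 mem_U1 axialFn_mem gaugeAct_mem norm_units_inv_conj_sub_one_le bavg expUnit val_expUnit)
open B7Prop1Local (InBox bondHi AgreeOn)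
open B8Lemma1NonAbelian (PlaqSmall)
open B10Eq27TorusAxialLog (gaugeActT gaugeActT_apply)
open HalvingCombPairGauge (dbavg_gaugeAct_eq_of_blockConst norm_gaugeAct_pairGauge_sub_one_le)
open HalvingCombStepGeometry (coverAt_sec sec_coverAt lift_twoBlock_bond norm_inv_gaugeActT_mul_gaugeAct_sub_one_le norm_sub_le_of_inv_mul blockMap_smul_add_boxVec
  pairGauge_values)
open B7Prop3Flat (dbavg expCfg C1)
open B7Prop4Flat (C2 c4 C1_pos)
open B7Prop5Flat (dbavg_congr)
open MatrixLog (mlog exp_mlog norm_mlog_le_two_mul)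
open Summit.QuantumFields.YangMills.Theorems.Prop8ChartDoubleBar (dbarAvgU norm_dbarAvgU_sub_one_le)
open HalvingCombTorusOneStep (norm_mlog_dbavg_sub_mlog_dbarAvgU_le)
open HalvingDbarLipschitz (norm_dbarAvgU_inv_mul_sub_one_le)
open HalvingDbavgOneStepLocal (norm_mlog_dbavg_sub_linQ_le_local)
open P1FlatCoreCovariance (dbarAvgU_gaugeActT_of_blockConst)
open HalvingTopCrossingDictionaryCore (norm_inv_mul_sub_one_le_of_exp)
open Prop7SymFrameIterSmall (norm_mul_sub_one_le_three)
open HalvingCombStepReadings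

variable {P : Params} {j : ℕ} {n : Type*} [Fintype n] [DecidableEq n] [Nonempty n]

/-- ★ **THE SECOND-ORDER LEG** (✓B-al-1 closed multiplicatively).  For the sectioned pair-gauged field `S` (generic block-constant gauge `f` with `f(π_{j+1}z) = 1`,
`f(ĉ₊) = axialFn C (Lz) (L(z+e_κ))`, `f ⊂ U1`): the torus double bar of `S` at `ĉ` and the `ℤᵈ` flat double bar of `v•C` at `(Lz, κ)` agree to second order,
`‖(dbarAvgU S ĉ)⁻¹ · dbavg L (v•C) (Lz) κ − 1‖ ≤ exp(2a′ + r₂)·r₂`, `r₂ = c₁·(L·2δ)²`, `a′ = 2(Lδ + 3800((d+2)L)²δ²)`, `δ = δc·p`, under `200(d+2)L·2δ ≤ 1`, `L·2δ ≤ c₄`.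
[cite: Balaban1985Averaging, (89) p.31, (121)-(125) p.36, Prop. 4 (134)-(135) pp.38-39; Balaban1987RG1, (0.4) p.253] -/
theorem norm_inv_dbarAvgU_mul_dbavg_sub_one_le (hj2 : j + 2 ≤ P.m + P.K) (C : Pt P.d → Fin P.d → (Matrix n n ℂ)ˣ) (hCU : ∀ x μ, C x μ ∈ U1 (Matrix n n ℂ))
    (f : Site P (j + 1) → (Matrix n n ℂ)ˣ) (hfU : ∀ y, f y ∈ U1 (Matrix n n ℂ)) (z : Pt P.d) (κ : Fin P.d)
    (hf0 : f (coverAt P (j + 1) z) = 1) (hf1 : f (coverAt P (j + 1) (z + e κ)) = axialFn C ((P.L : ℤ) • z) ((P.L : ℤ) • (z + e κ)))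
    {p : ℝ} (hp : 0 ≤ p) (hP : PlaqSmall C ((P.L : ℤ) • z) (bondHi P.L ((P.L : ℤ) • z) κ) p)
    (hblk : ∀ (w : Pt P.d) (r : Fin P.d → Fin P.L), axialFn C ((P.L : ℤ) • w) ((P.L : ℤ) • w + boxVec P.L r) = 1)
    (hℓr : 200 * (((P.d + 2) * P.L : ℕ) : ℝ) * (2 * ((((2 * (P.d * P.L) + 1) * (P.d * (P.L - 1) + P.L) : ℕ) : ℝ) * p)) ≤ 1)
    (hLr : (P.L : ℝ) * (2 * ((((2 * (P.d * P.L) + 1) * (P.d * (P.L - 1) + P.L) : ℕ) : ℝ) * p)) ≤ c4 P.d) :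
    ‖(((dbarAvgU (fun b : PBond P j => gaugeAct (fun w => f (blockOf (coverAt P j w))) C
            ((P.L : ℤ) • z + fun ν => ((b.src ν - coverAt P j ((P.L : ℤ) • z) ν).val : ℤ)) b.dir) ⟨coverAt P (j + 1) z, κ⟩)⁻¹ *
          dbavg P.L (gaugeAct (fun w => f (blockOf (coverAt P j w))) C) ((P.L : ℤ) • z) κ : (Matrix n n ℂ)ˣ) : Matrix n n ℂ) - 1‖ ≤
      Real.exp (2 * (2 * ((P.L : ℝ) * ((((2 * (P.d * P.L) + 1) * (P.d * (P.L - 1) + P.L) : ℕ) : ℝ) * p) +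
          3800 * (((P.d + 2) * P.L : ℕ) : ℝ) ^ 2 * ((((2 * (P.d * P.L) + 1) * (P.d * (P.L - 1) + P.L) : ℕ) : ℝ) * p) ^ 2)) +
          (C2 P.d + 40000 * ((P.d : ℝ) + 2) ^ 2) * ((P.L : ℝ) * (2 * ((((2 * (P.d * P.L) + 1) * (P.d * (P.L - 1) + P.L) : ℕ) : ℝ) * p))) ^ 2) *
        ((C2 P.d + 40000 * ((P.d : ℝ) + 2) ^ 2) * ((P.L : ℝ) * (2 * ((((2 * (P.d * P.L) + 1) * (P.d * (P.L - 1) + P.L) : ℕ) : ℝ) * p))) ^ 2) := by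
  have hj : j + 1 ≤ P.m + P.K := by omega
  have hL2 : 2 ≤ P.L := P.hL.2
  have hL1 : 1 ≤ P.L := by omega
  set q : Pt P.d := (P.L : ℤ) • z with hq
  set ĉ : PBond P (j + 1) := ⟨coverAt P (j + 1) z, κ⟩ with hĉ
  set δ : ℝ := (((2 * (P.d * P.L) + 1) * (P.d * (P.L - 1) + P.L) : ℕ) : ℝ) * p with hδ
  set v : Pt P.d → (Matrix n n ℂ)ˣ := fun w => f (blockOf (coverAt P j w)) with hv
  set S : GaugeField P j (Matrix n n ℂ)ˣ := fun b => gaugeAct v C (q + fun ν => ((b.src ν - coverAt P j q ν).val : ℤ)) b.dir with hSdef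
  have hδ0 : 0 ≤ δ := by rw [hδ]; positivity
  have hℓ0 : (0 : ℝ) ≤ (((P.d + 2) * P.L : ℕ) : ℝ) := Nat.cast_nonneg _
  have hδ1 : δ < 1 / 2 := by
    have hℓ1 : (1 : ℝ) ≤ (((P.d + 2) * P.L : ℕ) : ℝ) := by exact_mod_cast Nat.one_le_iff_ne_zero.mpr (Nat.mul_ne_zero (by omega) (by omega))
    nlinarith
  -- box readings: `v•C` is `δ`-small on `Q` and equals `S ∘ π_j` there
  have hbox : ∀ (x : Pt P.d) (μ : Fin P.d), InBox q (bondHi P.L q κ) x → InBox q (bondHi P.L q κ) (x + e μ) →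
      ‖((gaugeAct v C x μ : (Matrix n n ℂ)ˣ) : Matrix n n ℂ) - 1‖ ≤ δ :=
    fun x μ hx hxe => norm_pairGauge_sub_one_le hj2 C hCU f hfU z κ hf0 hf1 hp hP hblk x μ hx hxe
  have hSπ : ∀ (x : Pt P.d) (μ : Fin P.d), InBox q (bondHi P.L q κ) x → S ⟨coverAt P j x, μ⟩ = gaugeAct v C x μ := fun x μ hx => by
    simp only [hSdef]; exact box_reading hj2 (gaugeAct v C) z κ x μ hx
  -- two-block readings of `S`: lifted into `Q`
  have hS2 : ∀ b : PBond P j, (blockOf b.src = ĉ.src ∨ blockOf b.src = ĉ.tgt) → (blockOf b.tgt = ĉ.src ∨ blockOf b.tgt = ĉ.tgt) →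
      ‖((S b : (Matrix n n ℂ)ˣ) : Matrix n n ℂ) - 1‖ ≤ δ := fun b hs ht => by
    obtain ⟨x, hxs, hxt, hxQ, hxeQ⟩ := lift_twoBlock_bond hj2 z κ b hs ht
    have hsec : (q + fun ν => ((b.src ν - coverAt P j q ν).val : ℤ)) = x := by
      rw [← hxs]; exact sec_coverAt q x (window_of_inBox hj2 z x κ hxQ)
    simp only [hSdef, hsec]
    exact hbox x b.dir hxQ hxeQ
  -- (b) locality: `dbavg L (v•C) q κ = dbavg L (expCfg B) q κ`, `B = mlog ∘ S ∘ π_j`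
  set B : Pt P.d → Fin P.d → Matrix n n ℂ := fun w μ => mlog ((S ⟨coverAt P j w, μ⟩ : (Matrix n n ℂ)ˣ) : Matrix n n ℂ) with hB
  have hagree : AgreeOn q (bondHi P.L q κ) (gaugeAct v C) (expCfg B) := fun x μ hx hxe => by
    apply Units.ext
    rw [expCfg, val_expUnit, hB]
    dsimp only
    rw [hSπ x μ hx, exp_mlog ((hbox x μ hx hxe).trans_lt (by linarith))]
  have hb : dbavg P.L (gaugeAct v C) q κ = dbavg P.L (expCfg B) q κ := dbavg_congr P.L hL1 q κ hagree
  -- (c) ✓B-al-1 at `r = 2δ`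
  have hBr : ∀ (x : Pt P.d) (μ : Fin P.d), InBox q (bondHi P.L q κ) x → InBox q (bondHi P.L q κ) (x + e μ) → ‖B x μ‖ ≤ 2 * δ := fun x μ hx hxe => by
    simp only [hB, hSπ x μ hx]
    exact (norm_mlog_le_two_mul ((hbox x μ hx hxe).trans (by linarith))).trans (by linarith [hbox x μ hx hxe])
  have hXr : ∀ b : PBond P j, (blockOf b.src = ĉ.src ∨ blockOf b.src = ĉ.tgt) → (blockOf b.tgt = ĉ.src ∨ blockOf b.tgt = ĉ.tgt) →
      ‖mlog ((S b : (Matrix n n ℂ)ˣ) : Matrix n n ℂ)‖ ≤ 2 * δ := fun b hs ht =>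
    (norm_mlog_le_two_mul ((hS2 b hs ht).trans (by linarith))).trans (by linarith [hS2 b hs ht])
  have hSexp : ∀ b : PBond P j, (blockOf b.src = ĉ.src ∨ blockOf b.src = ĉ.tgt) → (blockOf b.tgt = ĉ.src ∨ blockOf b.tgt = ĉ.tgt) →
      ((S b : (Matrix n n ℂ)ˣ) : Matrix n n ℂ) = exp (mlog ((S b : (Matrix n n ℂ)ˣ) : Matrix n n ℂ)) := fun b hs ht =>
    (exp_mlog ((hS2 b hs ht).trans_lt (by linarith))).symm
  have hc := norm_mlog_dbavg_sub_mlog_dbarAvgU_le hj hL2 (S := S) (X := fun b => mlog ((S b : (Matrix n n ℂ)ˣ) : Matrix n n ℂ)) B (fun w μ => rfl) z κ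
    (by positivity : (0 : ℝ) ≤ 2 * δ) hLr hℓr hSexp hXr hBr
  -- exponential forms of both sides and the closing
  have hZ := norm_mlog_dbavg_sub_linQ_le_local P.L hL2 B z κ (by positivity : (0 : ℝ) ≤ 2 * δ) hLr hBr
  have h48 : 48 * (((P.d + 2) * P.L : ℕ) : ℝ) * δ ≤ 1 := by nlinarith
  have hMsub := norm_dbarAvgU_sub_one_le hj (S := S) ĉ hδ0 h48 hS2
  have hM1 : ‖((dbarAvgU S ĉ : (Matrix n n ℂ)ˣ) : Matrix n n ℂ) - 1‖ ≤ 1 / 2 := by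
    refine hMsub.trans ?_
    have hLℓ : (P.L : ℝ) ≤ (((P.d + 2) * P.L : ℕ) : ℝ) := by exact_mod_cast Nat.le_mul_of_pos_left P.L (by omega)
    have hℓδ : (((P.d + 2) * P.L : ℕ) : ℝ) * δ ≤ 1 / 400 := by nlinarith
    have hLδ : (P.L : ℝ) * δ ≤ 1 / 400 := (mul_le_mul_of_nonneg_right hLℓ hδ0).trans hℓδ
    have h2 : (((P.d + 2) * P.L : ℕ) : ℝ) ^ 2 * δ ^ 2 ≤ 1 / 400 * (1 / 400) := by
      have e : (((P.d + 2) * P.L : ℕ) : ℝ) ^ 2 * δ ^ 2 = ((((P.d + 2) * P.L : ℕ) : ℝ) * δ) * ((((P.d + 2) * P.L : ℕ) : ℝ) * δ) := by ring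
      rw [e]; exact mul_le_mul hℓδ hℓδ (mul_nonneg hℓ0 hδ0) (by norm_num)
    linarith
  have hMexp : ((dbarAvgU S ĉ : (Matrix n n ℂ)ˣ) : Matrix n n ℂ) = exp (mlog ((dbarAvgU S ĉ : (Matrix n n ℂ)ˣ) : Matrix n n ℂ)) :=
    (exp_mlog (hM1.trans_lt (by norm_num))).symm
  have hMlog : ‖mlog ((dbarAvgU S ĉ : (Matrix n n ℂ)ˣ) : Matrix n n ℂ)‖ ≤ 2 * ((P.L : ℝ) * δ + 3800 * (((P.d + 2) * P.L : ℕ) : ℝ) ^ 2 * δ ^ 2) :=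
    (norm_mlog_le_two_mul hM1).trans (by linarith)
  have hcsym : ‖mlog ((dbarAvgU S ĉ : (Matrix n n ℂ)ˣ) : Matrix n n ℂ) - mlog ((dbavg P.L (expCfg B) q κ : (Matrix n n ℂ)ˣ) : Matrix n n ℂ)‖ ≤
      (C2 P.d + 40000 * ((P.d : ℝ) + 2) ^ 2) * ((P.L : ℝ) * (2 * δ)) ^ 2 := by
    rw [norm_sub_rev]; exact hc
  have hfin := norm_inv_mul_sub_one_le_of_exp (U := dbarAvgU S ĉ) (V := dbavg P.L (expCfg B) q κ) hMexp hZ.2.2 hMlog hcsym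
  rw [hb]
  exact hfin

/-- ★ **THE LIPSCHITZ LEG** (✓(B-iii) between `W = ṽ•D` and `S` on the two blocks).  With the induction hypothesis `H_j` on `ℤᵈ` and the window `10⁴·(d+2)L·(δ + (102∕100)ρ) ≤ 1`,
`δ, ρ ≤ 1∕200`: `‖(dbarAvgU W ĉ)⁻¹ · dbarAvgU S ĉ − 1‖ ≤ 2((d+2)L + L + 2d⌊(L−1)∕2⌋)·(102∕100)ρ`. [cite: Balaban1985Averaging, (89) p.31; Balaban1987RG1, (0.4) p.253] -/
theorem norm_inv_dbarAvgU_gauged_mul_dbarAvgU_sectioned_sub_one_le {𝔸 : Type*} [NormedRing 𝔸] [NormedAlgebra ℂ 𝔸] [CompleteSpace 𝔸] [NormOneClass 𝔸]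
    (hj2 : j + 2 ≤ P.m + P.K) (C : Pt P.d → Fin P.d → 𝔸ˣ) (hCU : ∀ x μ, C x μ ∈ U1 𝔸) (D : GaugeField P j 𝔸ˣ)
    (f : Site P (j + 1) → 𝔸ˣ) (hfU : ∀ y, f y ∈ U1 𝔸) (z : Pt P.d) (κ : Fin P.d)
    (hf0 : f (coverAt P (j + 1) z) = 1) (hf1 : f (coverAt P (j + 1) (z + e κ)) = axialFn C ((P.L : ℤ) • z) ((P.L : ℤ) • (z + e κ)))
    {p ρ : ℝ} (hp : 0 ≤ p) (hρ : 0 ≤ ρ) (hP : PlaqSmall C ((P.L : ℤ) • z) (bondHi P.L ((P.L : ℤ) • z) κ) p)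
    (hblk : ∀ (w : Pt P.d) (r : Fin P.d → Fin P.L), axialFn C ((P.L : ℤ) • w) ((P.L : ℤ) • w + boxVec P.L r) = 1)
    (hH : ∀ (x : Pt P.d) (μ : Fin P.d), ‖(((D ⟨coverAt P j x, μ⟩)⁻¹ * C x μ : 𝔸ˣ) : 𝔸) - 1‖ ≤ ρ)
    (hδw : (((2 * (P.d * P.L) + 1) * (P.d * (P.L - 1) + P.L) : ℕ) : ℝ) * p ≤ 1 / 200) (hρw : ρ ≤ 1 / 200)
    (hwin : 10000 * (((P.d + 2) * P.L : ℕ) : ℝ) * ((((2 * (P.d * P.L) + 1) * (P.d * (P.L - 1) + P.L) : ℕ) : ℝ) * p + 102 / 100 * ρ) ≤ 1) :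
    ‖(((dbarAvgU (gaugeActT (fun y : Site P j => f (blockOf y)) D) ⟨coverAt P (j + 1) z, κ⟩)⁻¹ *
          dbarAvgU (fun b : PBond P j => gaugeAct (fun w => f (blockOf (coverAt P j w))) C
            ((P.L : ℤ) • z + fun ν => ((b.src ν - coverAt P j ((P.L : ℤ) • z) ν).val : ℤ)) b.dir) ⟨coverAt P (j + 1) z, κ⟩ : 𝔸ˣ) : 𝔸) - 1‖ ≤
      2 * ((((P.d + 2) * P.L : ℕ) : ℝ) + P.L + 2 * ((P.d * ((P.L - 1) / 2) : ℕ) : ℝ)) * (102 / 100 * ρ) := by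
  have hj : j + 1 ≤ P.m + P.K := by omega
  set δ : ℝ := (((2 * (P.d * P.L) + 1) * (P.d * (P.L - 1) + P.L) : ℕ) : ℝ) * p with hδ
  have hδ0 : 0 ≤ δ := by rw [hδ]; positivity
  have hread := fun (b : PBond P j) hs ht => twoBlock_readings hj2 C hCU D f hfU z κ hf0 hf1 hp hP hblk hH hδw hρw b hs ht
  exact norm_dbarAvgU_inv_mul_sub_one_le hj ⟨coverAt P (j + 1) z, κ⟩ (by positivity : (0 : ℝ) ≤ δ + 102 / 100 * ρ) (by positivity : (0 : ℝ) ≤ 102 / 100 * ρ) hwin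
    (fun b hs ht => (hread b hs ht).2.2) (fun b hs ht => (hread b hs ht).1.trans (by nlinarith)) (fun b hs ht => (hread b hs ht).2.1)

/-- ★★ **LEMMA B-al-2, THE LEVEL STEP `H_j ⇒ H_{j+1}` (px3 g5's `hstep` text).**  For a `U1`-valued `ℤᵈ` field `C` that is block-axial on every block and has plaquettes `≤ p` on
every box, and a torus field `D` on `T^{(j)}` with `‖D(π_j b)⁻¹·C(b) − 1‖ ≤ ρ` at every `ℤᵈ` bond, under `10⁴·((d+2)L)·(δc·p + 2ρ) ≤ 1` and `L·(2·δc·p) ≤ c₄(d)`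
(`δc = (2dL+1)(d(L−1)+L)`): at every coarse bond `ĉ = ⟨π_{j+1} z, κ⟩`,
`‖(dbarAvgU D ĉ)⁻¹ · bavg L C (Lz) κ − 1‖ ≤ (11∕10)·2((d+2)L + L + 2·d⌊(L−1)∕2⌋)·ρ + 5·(C₂(d) + 40000(d+2)²)·(L·(δc·p))²` — NO gauge factor.
[cite: Balaban1985Averaging, (42) p.23, (89) p.31, Prop. 4 (134)-(135) pp.38-39; Balaban1987RG1, (0.4) p.253; Balaban1985UV3, (27)-(28) p.263] -/
theorem norm_dbarAvgU_inv_mul_bavg_sub_one_le (hj2 : j + 2 ≤ P.m + P.K) (C : Pt P.d → Fin P.d → (Matrix n n ℂ)ˣ) (D : GaugeField P j (Matrix n n ℂ)ˣ)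
    (ρ p : ℝ) (hρ : 0 ≤ ρ) (hp : 0 ≤ p) (hCU : ∀ x μ, C x μ ∈ U1 (Matrix n n ℂ))
    (hblk : ∀ (z : Pt P.d) (r : Fin P.d → Fin P.L), axialFn C ((P.L : ℤ) • z) ((P.L : ℤ) • z + boxVec P.L r) = 1)
    (hP : ∀ lo hi : Pt P.d, PlaqSmall C lo hi p)
    (hH : ∀ (x : Pt P.d) (μ : Fin P.d), ‖(((D ⟨coverAt P j x, μ⟩)⁻¹ * C x μ : (Matrix n n ℂ)ˣ) : Matrix n n ℂ) - 1‖ ≤ ρ)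
    (hwin : 10 ^ 4 * (((P.d + 2) * P.L : ℕ) : ℝ) * ((((2 * (P.d * P.L) + 1) * (P.d * (P.L - 1) + P.L) : ℕ) : ℝ) * p + 2 * ρ) ≤ 1)
    (hLr : (P.L : ℝ) * (2 * ((((2 * (P.d * P.L) + 1) * (P.d * (P.L - 1) + P.L) : ℕ) : ℝ) * p)) ≤ c4 P.d)
    (z : Pt P.d) (κ : Fin P.d) :
    ‖(((dbarAvgU D ⟨coverAt P (j + 1) z, κ⟩)⁻¹ * bavg P.L C ((P.L : ℤ) • z) κ : (Matrix n n ℂ)ˣ) : Matrix n n ℂ) - 1‖ ≤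
      11 / 10 * (2 * ((((P.d + 2) * P.L : ℕ) : ℝ) + P.L + 2 * ((P.d * ((P.L - 1) / 2) : ℕ) : ℝ))) * ρ +
        5 * (C2 P.d + 40000 * ((P.d : ℝ) + 2) ^ 2) * ((P.L : ℝ) * ((((2 * (P.d * P.L) + 1) * (P.d * (P.L - 1) + P.L) : ℕ) : ℝ) * p)) ^ 2 := by
  classical
  have hj : j + 1 ≤ P.m + P.K := by omega
  have hL1 : 1 ≤ P.L := by have := P.hL.2; omega
  -- letters
  set q : Pt P.d := (P.L : ℤ) • z with hq
  set ĉ : PBond P (j + 1) := ⟨coverAt P (j + 1) z, κ⟩ with hĉ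
  set g : (Matrix n n ℂ)ˣ := axialFn C q ((P.L : ℤ) • (z + e κ)) with hg
  set δ : ℝ := (((2 * (P.d * P.L) + 1) * (P.d * (P.L - 1) + P.L) : ℕ) : ℝ) * p with hδ
  set ℓ : ℝ := (((P.d + 2) * P.L : ℕ) : ℝ) with hℓ
  have h104 : (10 : ℝ) ^ 4 = 10000 := by norm_num
  rw [h104] at hwin
  have hδ0 : 0 ≤ δ := by rw [hδ]; positivity
  have hℓ1 : (1 : ℝ) ≤ ℓ := by rw [hℓ]; exact_mod_cast Nat.one_le_iff_ne_zero.mpr (Nat.mul_ne_zero (by omega) (by omega))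
  have hLℓ : (P.L : ℝ) ≤ ℓ := by rw [hℓ]; exact_mod_cast Nat.le_mul_of_pos_left P.L (by omega)
  obtain ⟨hδw, hρw, hℓr, -, hwin3, -⟩ := windows_arith hℓ1 hLℓ hδ0 hρ hwin
  -- the pair gauge `f = 1 ⊔ g`
  have hgU : g ∈ U1 (Matrix n n ℂ) := axialFn_mem hCU _ _
  obtain ⟨-, -, hf0, hfg⟩ := pairGauge_values hj2 (1 : (Matrix n n ℂ)ˣ) g z κ
  set f : Site P (j + 1) → (Matrix n n ℂ)ˣ := Function.update (fun _ => (1 : (Matrix n n ℂ)ˣ)) ĉ.tgt g with hf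
  have hfU : ∀ y, f y ∈ U1 (Matrix n n ℂ) := update_mem_U1 ĉ.tgt hgU
  have hf1 : f (coverAt P (j + 1) (z + e κ)) = g := by rw [← tgt_coverAt]; exact hfg
  -- (a) `dbavg L (v•C) q κ = bavg L C q κ · g⁻¹` (✓(B-ii))
  have ha : dbavg P.L (gaugeAct (fun w => f (blockOf (coverAt P j w))) C) q κ = bavg P.L C q κ * g⁻¹ := by
    rw [hq, dbavg_gaugeAct_eq_of_blockConst P.L C (fun w => f (blockOf (coverAt P j w))) z κ (hblk z) (hblk (z + e κ))
      (fun r => by rw [pairGauge_block hj f, pairGauge_corner hj f]) (fun r => by rw [pairGauge_block hj f, pairGauge_corner hj f]),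
      pairGauge_corner hj f, pairGauge_corner hj f, hf0, hf1, ← hq, one_mul]
  -- (c) the second-order leg and (d) the Lipschitz leg
  have ha₂ := norm_inv_dbarAvgU_mul_dbavg_sub_one_le hj2 C hCU f hfU z κ hf0 hf1 hp (hP _ _) hblk (by rw [hδ] at hℓr; exact hℓr) (by rw [hδ] at hLr; exact hLr)
  have ha₁ := norm_inv_dbarAvgU_gauged_mul_dbarAvgU_sectioned_sub_one_le hj2 C hCU D f hfU z κ hf0 hf1 hp hρ (hP _ _) hblk hH (by rw [hδ] at hδw; exact hδw) hρw
    (by rw [hδ] at hwin3; exact hwin3)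
  rw [← hδ, ← hℓ] at ha₂
  rw [← hℓ] at ha₁
  -- (e) covariance of the double bar under the block-constant gauge: `dbarAvgU (ṽ•D) ĉ = dbarAvgU D ĉ · g⁻¹`
  have he : dbarAvgU (gaugeActT (fun y : Site P j => f (blockOf y)) D) ĉ = dbarAvgU D ĉ * g⁻¹ := by
    rw [dbarAvgU_gaugeActT_of_blockConst hj (fun y : Site P j => f (blockOf y)) f (fun _ => rfl) D, gaugeActT_apply, hfg,
      show f ĉ.src = 1 from hf0, one_mul]
  -- (f) assemble: `D̿⁻¹·C̄ = g⁻¹·[(W̿)⁻¹S̿]·[S̿⁻¹·dbavg(v•C)]·g`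
  set S : GaugeField P j (Matrix n n ℂ)ˣ := fun b => gaugeAct (fun w => f (blockOf (coverAt P j w))) C (q + fun ν => ((b.src ν - coverAt P j q ν).val : ℤ)) b.dir
    with hSdef
  have hkey : (dbarAvgU D ĉ)⁻¹ * bavg P.L C q κ =
      g⁻¹ * (((dbarAvgU (gaugeActT (fun y : Site P j => f (blockOf y)) D) ĉ)⁻¹ * dbarAvgU S ĉ) *
        ((dbarAvgU S ĉ)⁻¹ * dbavg P.L (gaugeAct (fun w => f (blockOf (coverAt P j w))) C) q κ)) * g := by
    have hT : bavg P.L C q κ = dbavg P.L (gaugeAct (fun w => f (blockOf (coverAt P j w))) C) q κ * g := by rw [ha, inv_mul_cancel_right]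
    rw [hT, he]; group
  rw [hkey, Units.val_mul, Units.val_mul]
  refine (norm_units_inv_conj_sub_one_le hgU _).trans ?_
  rw [Units.val_mul]
  refine (norm_mul_sub_one_le_three _ _).trans ?_
  -- arithmetic
  have hm2 : 2 * ((P.d * ((P.L - 1) / 2) : ℕ) : ℝ) ≤ ℓ := by
    rw [hℓ]
    have : 2 * (P.d * ((P.L - 1) / 2)) ≤ (P.d + 2) * P.L := by
      calc 2 * (P.d * ((P.L - 1) / 2)) = P.d * (2 * ((P.L - 1) / 2)) := by ring
        _ ≤ P.d * P.L := Nat.mul_le_mul_left _ (by omega)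
        _ ≤ (P.d + 2) * P.L := Nat.mul_le_mul_right _ (by omega)
    exact_mod_cast this
  have hddL : ((P.d : ℝ) + 2) * P.L ≤ ℓ := by rw [hℓ]; push_cast; exact le_of_eq (by ring)
  have hC20 : 0 ≤ C2 P.d := by unfold C2; have := C1_pos P.d; positivity
  have hC2w : C2 P.d * (2 * (P.L : ℝ) * δ) ≤ 1 := by
    have hc4 : c4 P.d * C2 P.d = 1 := by
      have := C1_pos P.d
      unfold c4 C2; field_simp
    calc C2 P.d * (2 * (P.L : ℝ) * δ) = ((P.L : ℝ) * (2 * δ)) * C2 P.d := by ring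
      _ ≤ c4 P.d * C2 P.d := mul_le_mul_of_nonneg_right hLr hC20
      _ = 1 := hc4
  exact step_arith (dd := (P.d : ℝ) + 2) (C := C2 P.d) hℓ1 hLℓ (Nat.cast_nonneg _) hm2 (by positivity) hddL hδ0 hρ hC20 hwin hC2w rfl
    le_rfl (by positivity) ha₁ (norm_nonneg _) ha₂ (norm_nonneg _)


end Summit.QuantumFields.YangMills.Theorems.HalvingCombStep

end
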